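import Summits.ResolutionOfSingularities.ResolutionOfSingularities.Theorems.FrobeniusClosingPatchingRelPerfectDepthFlagTargets
import HarnessLib

/-!
# Chain W5.2 — «F6» stage 1, T6-E1b `StageOneFlagScoped₃`: the RESIDUAL TARGETS of record at `ℓ = 2`
# (companion cascade ⊕ divisorial end game ⊕ weight-two-LEGAL order reduction of a principal marked ideal)

[OURS · L1 W5.2 · res-L1-w52-idea-1 gen 7 (IDEATOR 1, card C «coefficient flag on the exceptional ℙ³», ROUND 8b/8c;
Sketch v9) · booked by res-L1-w52-plan-1 RULING R3 (a) 2026-08-27T11:27:37Z]  NOT statements of the manuscript under review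
(Hironaka 2017); AI-typed, weaker than expert review.  DEFINITIONS ONLY and FACT-FREE: no named fact occurs in this file.  F-33
(Cossart–Piltant 2008, Prop. 4.4) is NOT an admissible premise of this chain; the intended closer of `Cascade₂` carries it as an
explicit binder labelled CONDITIONAL, in its own module.  The PROVED glue between these targets and plan-1's `StageOneFlag₃` /
`StageOneFlagScoped₃` / `StageOnePrephase₃` (tree `…DepthFlagTargets`) is the sibling module `…DepthFlagLegalGlue` (def-free).

THE PICTURE (all arrows of the glue module are kernel-checked; `F-32bR` = `CossartJannsenSaito2020EmbeddedSequenceB`):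
* `Cascade₂` — the companion cascade at `N = 2` in the flag format: from any stage-1 state reach `CascadeEnd₂`
  (`𝔟' ⊔ R₁'² = H · J`, `H` effective Cartier, `ord J ≤ 1`, `V(J) ∩ V(H) = ∅`).  Size M modulo the F-33 ∃-form.
* `EndGame₂` — from `CascadeEnd₂` reach `EndFlag`.  PROVED from `LegalDivisorReduction₃` in the glue module
  (`endGame₂_of_legalDivisorReduction₃`: factor transport along the diagonal game of `H`, the factor `J` is inert).
* `LegalDivisorReduction₃` ⊇ `LegalScopedDivisorReduction₃` — weight-two-LEGAL order reduction of the principal marked ideal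
  `(H, 2)` (all `H`, resp. `H` without multiple components = `FlagScope H H`) = the DIAGONAL `𝔟 = R₁ = H` of `StageOneFlag₃`
  (resp. `StageOneFlagScoped₃`); NECESSARY for them (one-line specialisations) and, with `Cascade₂`, SUFFICIENT.  OURS, OPEN, L.
* `ScopePhase₃` — reach `FlagScope` legally from the diagonal; = the diagonal of T6-E1a `StageOnePrephase₃`, hence CLOSED modulo
  F-32bR by res-type-049's `stageOnePrephase₃_of_cjsB`; it is the seam `ScopePhase₃ → LegalScopedDivisorReduction₃ →
  LegalDivisorReduction₃` (PROVED).
NET (glue module): modulo ⟨`Cascade₂`, F-32bR⟩, `StageOneFlagScoped₃ ↔ StageOneFlag₃ ↔ LegalScopedDivisorReduction₃ ↔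
LegalDivisorReduction₃`.  So the ONE open OURS statement behind T6-E1/T6-E1b beyond the F-33 cascade is
`LegalScopedDivisorReduction₃`: idealistic-format (weight-two-LEGAL: every centre inside `{ord H_k ≥ 2}`) embedded resolution of
REDUCED surfaces in regular excellent threefolds, ending with `ord H_m ≤ 1` everywhere (positive components regular and pairwise
disjoint).  WHY IT MIGHT FAIL: the Cossart–Jannsen–Saito second cycle (n.c. with the boundary) passes through order-ONE points
(witness `H = V(xy − z³)`: after the legal point blow-up the strict transform is regular, meets the multiplicity-ZERO exceptional
plane in a node, `EndFlag` already holds, and the CJS n.c.-step at the node has order 1 — flag-ILLEGAL); no printed algorithm is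
organised «centres of multiplicity ≥ 2 only, then separate from the POSITIVE-multiplicity exceptionals only».

## References
* V. Cossart, U. Jannsen, S. Saito, *Desingularization: invariants and strategy*, LNM 2270 (2020), Thm. 1.3–1.4, 5.9/6.9.
  [CossartJannsenSaito2020]
* V. Cossart, O. Piltant, J. Algebra 320 (2008), Prop. 4.4. [CossartPiltant2008]
* J. Kollár, *Lectures on Resolution of Singularities* (2007), 3.111 Step 3. [Kollar2007]
* E. Bierstone, D. Grigoriev, P. Milman, J. Włodarczyk (2011), §3.2. [BierstoneGrigorievMilmanWlodarczyk2011]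
-/

-- `Summit.<Summit>.<Sub>.Theorems` with `Sub = Summit` (single-conjunct summit, D-0017)
set_option linter.dupNamespace false

noncomputable section

open CategoryTheory CategoryTheory.Limits AlgebraicGeometry TopologicalSpace
open Literature.AlgebraicGeometry.Resolution
open Scheme.IdealSheafData

namespace Summit.ResolutionOfSingularities.ResolutionOfSingularities.Theorems.DepthTargets

universe u

/-- [OURS · L1 W5.2] **The CASCADE END STATE at `N = 2`** (read on the flag `(𝔟, R₁)`, marked ideal `𝒥 = 𝔟 ⊔ R₁²`): `𝒥`
factors as `H · J` with `H` an effective Cartier divisor (the divisorial part: initial strict transforms AND cascade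
exceptionals, NO snc information), `ord_x J ≤ 1` everywhere, and `V(J) ∩ V(H) = ∅` (`ord_x J ≥ 1 ⇒ ord_x H = 0`).  Hence
`Sing(𝒥, 2) = Sing(H, 2)`, disjoint from `supp J`.  NOT a statement of the manuscript.
(cf. Kollár 2007 = bib Kollar2007, 3.111 Step 3 — OURS node; pointer in prose) -/
def CascadeEnd₂ (E : Scheme.{u}) (𝔟 R₁ : E.IdealSheafData) : Prop :=
  ∃ H J : E.IdealSheafData, 𝔟 ⊔ R₁ ^ 2 = H * J ∧ IsEffectiveCartier H ∧
    (∀ x, idealOrder J x ≤ 1) ∧ ∀ x, (1 : ℕ∞) ≤ idealOrder J x → idealOrder H x = 0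

/-- [OURS · L1 W5.2] **TARGET `Cascade₂` — the companion cascade at `N = 2` in the flag format**: from any stage-1 state
`FlagState₃ E 𝔟 R₁` a flag sequence (`IsFlagSeq`: weight-two-legal regular centres) reaching `CascadeEnd₂`.  UNSCOPED
(`FlagScope` not used).  Intended proof (res-L1-w52-idea-1 card C §5, Sketch v9 §3–§6; size M): CONDITIONAL on the F-33
∃-form `CossartPiltant2008_prop44` (NOT an admissible premise of this chain — an explicit binder of the closer) plus the OURS
descent lemma `CompanionDescent`; `N = 2` is the unique marking for which centres in singular loci are automatically legal.
NOT a statement of the manuscript.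
(cf. Cossart–Piltant 2008 = bib CossartPiltant2008, Prop. 4.4 — OURS node; pointer in prose, the Prop being parameterless) -/
def Cascade₂ : Prop :=
  ∀ (E : Scheme.{u}) [IsIntegral E] [IsNoetherian E], Scheme.IsRegular E → Scheme.IsExcellent E →
    topologicalKrullDim E = 3 →
    ∀ (𝔟 R₁ : E.IdealSheafData), 𝔟 ≠ ⊥ → IsLocallyPrincipal 𝔟 → 𝔟 ≤ R₁ →
      ∃ (E' : Scheme.{u}) (ρ : E' ⟶ E) (𝔟' R₁' : E'.IdealSheafData),
        IsFlagSeq ρ 𝔟 R₁ 𝔟' R₁' ∧ FlagState₃ E' 𝔟' R₁' ∧ CascadeEnd₂ E' 𝔟' R₁'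

/-- [OURS · L1 W5.2] **TARGET `EndGame₂` — the divisorial END GAME at `N = 2`**: from `CascadeEnd₂` reach `EndFlag` by a
flag sequence.  PROVED from `LegalDivisorReduction₃` (glue module `endGame₂_of_legalDivisorReduction₃`: run the diagonal game
of `H` and transport; the factor `J` is inert because every centre lies in `supp H' ⊆ E' ∖ ρ⁻¹ supp J`).  NOT a statement of the
manuscript. (cf. Kollár 2007 = bib Kollar2007, 3.111 Step 3 — OURS node; pointer in prose, the Prop being parameterless) -/
def EndGame₂ : Prop :=
  ∀ (E : Scheme.{u}) (𝔟 R₁ : E.IdealSheafData), FlagState₃ E 𝔟 R₁ → CascadeEnd₂ E 𝔟 R₁ →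
    ∃ (E' : Scheme.{u}) (ρ : E' ⟶ E) (𝔟' R₁' : E'.IdealSheafData),
      IsFlagSeq ρ 𝔟 R₁ 𝔟' R₁' ∧ FlagState₃ E' 𝔟' R₁' ∧ EndFlag 𝔟' R₁'

/-- [OURS · L1 W5.2] **TARGET `LegalDivisorReduction₃` — weight-two-LEGAL ORDER REDUCTION OF A PRINCIPAL MARKED IDEAL
`(H, 2)` on a regular excellent threefold** = the DIAGONAL instance `𝔟 = R₁ = H` of `StageOneFlag₃` (`𝒥 = H ⊔ H² = H`; member
`ḡ = 0`, the purely inseparable double cover `t² = f̄`): idealistic-format embedded resolution of (possibly non-reduced)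
surfaces, every centre inside `{ord H_k ≥ 2}`, ending with `ord H_m ≤ 1` everywhere.  NECESSARY for `StageOneFlag₃`
(`legalDivisorReduction₃_of_stageOneFlag₃`) and, with `Cascade₂`, SUFFICIENT (`stageOneFlag₃_iff_legal`); equivalent to the
scoped form modulo F-32bR (`legalDivisorReduction₃_iff_scoped_of_cjsB`).  OURS, OPEN, L.  Why it might fail: see
`LegalScopedDivisorReduction₃`.  NOT a statement of the manuscript.
(cf. Cossart–Jannsen–Saito 2020 = bib CossartJannsenSaito2020, Thm. 1.3–1.4 — OURS node; pointer in prose, the Prop being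
parameterless) -/
def LegalDivisorReduction₃ : Prop :=
  ∀ (E : Scheme.{u}) [IsIntegral E] [IsNoetherian E], Scheme.IsRegular E → Scheme.IsExcellent E →
    topologicalKrullDim E = 3 →
    ∀ (H : E.IdealSheafData), H ≠ ⊥ → IsLocallyPrincipal H →
      ∃ (E' : Scheme.{u}) (ρ : E' ⟶ E) (𝔟' R₁' : E'.IdealSheafData),
        IsFlagSeq ρ H H 𝔟' R₁' ∧ FlagState₃ E' 𝔟' R₁' ∧ EndFlag 𝔟' R₁'

/-- [OURS · L1 W5.2] **TARGET `LegalScopedDivisorReduction₃` — the REDUCED case = THE open OURS statement behind T6-E1b**: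
the diagonal of `StageOneFlagScoped₃`; `FlagScope H H` says `Sing(H, 2)` has codimension `≥ 2`, i.e. the Cartier divisor `H` has
no multiple component.  = weight-two-LEGAL embedded resolution of REDUCED surfaces in regular excellent threefolds: every centre
regular and inside `{ord H_k ≥ 2}` (so inside `Sing` of the reduced total transform with its POSITIVE-multiplicity exceptionals),
ending with `ord H_m ≤ 1` everywhere (positive components regular and pairwise disjoint).  NECESSARY for the scoped target
(`legalScopedDivisorReduction₃_of_stageOneFlagScoped₃`) and SUFFICIENT modulo ⟨`Cascade₂`, F-32bR⟩
(`stageOneFlagScoped₃_iff_scoped_of_cjsB`).  OURS, OPEN, L.  Why it might fail: a legal strategy must resolve the reduced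
singular surface using ONLY centres of multiplicity `≥ 2` of the total transform and then separate the strict transform from the
positive-multiplicity exceptionals without passing through an order-one point; the Cossart–Jannsen–Saito second cycle (n.c. with
ALL exceptionals, F-32bR / F-60 as typed: `IsBPermissibleSequenceB`) does pass through such points (`H = V(xy − z³)`), F-32c is
non-embedded, Cutkosky 2009 Thm. 1.2 blows up the non-snc locus.  Plan (res-L1-w52-plan-1 RULING R3 (b), idea-1 ROUND 8c): CJS
first cycle truncated at the first regular stage (centres `⊆ X_max ⊆ Sing`; typing request F-32♯) · PEEL the even exceptionals ·
F-60 with boundary := the ODD exceptionals only, invariant «centres lie on an odd OLD component» (typing request F-60♯: centres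
O-permissible, old components only) · separate the double curves.  NOT a statement of the manuscript.
(cf. Cossart–Jannsen–Saito 2020 = bib CossartJannsenSaito2020, Thm. 1.3, Thm. 5.9; Cutkosky 2009 = arXiv:math/0606530 (v2, galaxy:pdf:-8660737924394494020),
Thm. 1.2 — OURS node; pointer in prose, the Prop being parameterless) -/
def LegalScopedDivisorReduction₃ : Prop :=
  ∀ (E : Scheme.{u}) [IsIntegral E] [IsNoetherian E], Scheme.IsRegular E → Scheme.IsExcellent E →
    topologicalKrullDim E = 3 →
    ∀ (H : E.IdealSheafData), H ≠ ⊥ → IsLocallyPrincipal H → FlagScope H H →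
      ∃ (E' : Scheme.{u}) (ρ : E' ⟶ E) (𝔟' R₁' : E'.IdealSheafData),
        IsFlagSeq ρ H H 𝔟' R₁' ∧ FlagState₃ E' 𝔟' R₁' ∧ EndFlag 𝔟' R₁'

/-- [OURS · L1 W5.2] **TARGET `ScopePhase₃` — reach scope legally from the diagonal**: for every non-zero locally principal
`H` on a regular excellent threefold a flag sequence `(H, H) ↦ (A', A₁')` ending in a SCOPED flag.  = the diagonal of T6-E1a
`StageOnePrephase₃`, hence CLOSED modulo F-32bR (glue module `scopePhase₃_of_cjsB`, by res-type-049's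
`stageOnePrephase₃_of_cjsB`); it is the seam between the scoped and unscoped residuals
(`legalDivisorReduction₃_of_scopePhase₃_of_scoped`, PROVED).  NOT a statement of the manuscript.
(cf. Cossart–Jannsen–Saito 2020 = bib CossartJannsenSaito2020, Thm. 1.4 — OURS node; pointer in prose, the Prop being
parameterless) -/
def ScopePhase₃ : Prop :=
  ∀ (E : Scheme.{u}) [IsIntegral E] [IsNoetherian E], Scheme.IsRegular E → Scheme.IsExcellent E →
    topologicalKrullDim E = 3 →
    ∀ (H : E.IdealSheafData), H ≠ ⊥ → IsLocallyPrincipal H →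
      ∃ (E' : Scheme.{u}) (ρ : E' ⟶ E) (A' A₁' : E'.IdealSheafData),
        IsFlagSeq ρ H H A' A₁' ∧ FlagState₃ E' A' A₁' ∧ FlagScope A' A₁'

end Summit.ResolutionOfSingularities.ResolutionOfSingularities.Theorems.DepthTargets

end
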